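import Mathlib
import Summits.Ventures.PercRepro2.TreeBlock
import Summits.Ventures.PercRepro2.LCNet
import Summits.Ventures.PercRepro2.CutNet

/-!
# Pendant parts are invisible to flows and cuts (seat mine-b, cell pub-perc-repro2)

A part `E₂` sharing only one vertex `v` with `E₁`, where both terminals are `E₁`-vertices, changes
neither the max-flow nor the packing number of closed cuts between the terminals: a walk of the
union between two `E₁`-vertices shortcuts inside `E₁` (`conn_block_of_walk`, TreeBlock.lean), so
`flowIn (E₁ ∪ E₂) k = flowIn E₁ k` (`flowIn_union_pendant`) and the cut events agree
(`genIn_sep_union_pendant`).  Hence rows B2 and B2* hold for every product measure on every graph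
whose terminal CORE (the edge set left after deleting the pendant parts) is in the class `LCNet`
resp. `CutNet` (`flow_logconcave_of_LCNet_core`, `cut_logconcave_of_CutNet_core`) — e.g. every
graph whose `s–t` block path is a series–parallel composition of small strands / small blocks,
with arbitrary graphs hanging off its vertices.
-/

open Finset

namespace Summit.Ventures.PercRepro2

open IFR

variable {V : Type*} {E : Type*} [Fintype E] [DecidableEq E]

omit [Fintype E] in
/-- a carrying set inside `E₁ ∪ E₂` (parts sharing only `v`) between two `E₁`-vertices carries
inside `E₁` -/
lemma carries_pendant {ends : E → Sym2 V} {v s t : V} {E₁ E₂ : Finset E}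
    (hE : SharesOnlyVertex ends v E₁ E₂) (hs : Touches ends E₁ s) (ht : Touches ends E₁ t)
    {K : Finset E} (hK : K ⊆ E₁ ∪ E₂) (hc : Carries ends K s t) : Carries ends (K ∩ E₁) s t := by
  classical
  obtain ⟨w⟩ := hc
  have := conn_block_of_walk hE hK w
  rwa [if_pos hs, if_pos ht] at this

/-- **flows ignore a pendant part** -/
theorem flowIn_union_pendant {ends : E → Sym2 V} {v s t : V} {E₁ E₂ : Finset E}
    (hE : SharesOnlyVertex ends v E₁ E₂) (hs : Touches ends E₁ s) (ht : Touches ends E₁ t) (k : ℕ) :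
    flowIn ends s t (E₁ ∪ E₂) k = flowIn ends s t E₁ k := by
  ext ω
  simp only [flowIn, Set.mem_setOf_eq]
  have h1 : openSet ω ∩ (E₁ ∪ E₂) ∩ E₁ = openSet ω ∩ E₁ := by
    ext e; simp only [Finset.mem_inter, Finset.mem_union]; tauto
  constructor
  · intro h
    have := kDisj_restrict_sub (incr_carries ends s t) (E₀ := E₁ ∪ E₂)
      (fun T hT hA => carries_pendant hE hs ht hT hA) k Finset.inter_subset_right h
    rwa [h1] at this
  · intro h
    exact incr_kDisj _ k (Finset.inter_subset_inter le_rfl Finset.subset_union_left) h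

/-- the flow tail ignores a pendant part -/
theorem flowTail_union_pendant (p : E → ℝ) {ends : E → Sym2 V} {v s t : V} {E₁ E₂ : Finset E}
    (hE : SharesOnlyVertex ends v E₁ E₂) (hs : Touches ends E₁ s) (ht : Touches ends E₁ t) :
    flowTail p ends s t (E₁ ∪ E₂) = flowTail p ends s t E₁ := by
  funext k
  unfold flowTail
  rw [flowIn_union_pendant hE hs ht]

/-- **row B2 on every graph whose terminal core is in `LCNet`** (the rest hangs off one vertex) -/
theorem flow_logconcave_of_LCNet_core {p : E → ℝ} (hp : IsProbVec p) {ends : E → Sym2 V} {v s t : V}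
    {E₁ E₂ : Finset E} (h : LCNet ends s t E₁) (hE : SharesOnlyVertex ends v E₁ E₂)
    (hs : Touches ends E₁ s) (ht : Touches ends E₁ t) (hcov : E₁ ∪ E₂ = Finset.univ) (k : ℕ) :
    prob p (flowEvent ends s t k) * prob p (flowEvent ends s t (k + 2))
      ≤ prob p (flowEvent ends s t (k + 1)) * prob p (flowEvent ends s t (k + 1)) := by
  have hk := h.flowIn_logconcave hp k
  rw [← flowIn_union_pendant hE hs ht, ← flowIn_union_pendant hE hs ht (k + 2),
    ← flowIn_union_pendant hE hs ht (k + 1), hcov, flowIn_univ, flowIn_univ, flowIn_univ] at hk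
  exact hk

omit [Fintype E] in
/-- separation inside the union with a pendant part is separation inside the core -/
lemma separatesIn_union_pendant {ends : E → Sym2 V} {v s t : V} {E₁ E₂ : Finset E}
    (hE : SharesOnlyVertex ends v E₁ E₂) (hs : Touches ends E₁ s) (ht : Touches ends E₁ t)
    (S : Finset E) : SeparatesIn ends (E₁ ∪ E₂) S s t ↔ SeparatesIn ends E₁ S s t := by
  constructor
  · intro h h₁
    exact h (Carries.mono (Finset.sdiff_subset_sdiff Finset.subset_union_left le_rfl) h₁)
  · intro h hc
    have e : (E₁ ∪ E₂) \ S ∩ E₁ = E₁ \ S := by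
      ext e; simp only [Finset.mem_inter, Finset.mem_sdiff, Finset.mem_union]; tauto
    have := carries_pendant hE hs ht (Finset.sdiff_subset) hc
    rw [e] at this
    exact h this

/-- **closed cuts ignore a pendant part** (in the language of `genIn`, complementary configuration) -/
theorem genIn_sep_union_pendant {ends : E → Sym2 V} {v s t : V} {E₁ E₂ : Finset E}
    (hE : SharesOnlyVertex ends v E₁ E₂) (hs : Touches ends E₁ s) (ht : Touches ends E₁ t) (k : ℕ) :
    genIn (fun S => SeparatesIn ends (E₁ ∪ E₂) S s t) (E₁ ∪ E₂) k
      = genIn (fun S => SeparatesIn ends E₁ S s t) E₁ k := by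
  ext ω
  simp only [genIn, Set.mem_setOf_eq]
  have h1 : openSet ω ∩ (E₁ ∪ E₂) ∩ E₁ = openSet ω ∩ E₁ := by
    ext e; simp only [Finset.mem_inter, Finset.mem_union]; tauto
  constructor
  · intro h
    have := kDisj_restrict (incr_separatesIn ends E₁ s t) E₁
      (fun T hT => (separatesIn_inter ends E₁ T s t).2 ((separatesIn_union_pendant hE hs ht T).1 hT))
      k h
    rwa [h1] at this
  · intro h
    have h' := kDisj_mono_pred (fun T hT => (separatesIn_union_pendant hE hs ht T).2 hT) k h
    exact incr_kDisj _ k (Finset.inter_subset_inter le_rfl Finset.subset_union_left) h'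

/-- the cut events ignore a pendant part -/
theorem cutIn_union_pendant {ends : E → Sym2 V} {v s t : V} {E₁ E₂ : Finset E}
    (hE : SharesOnlyVertex ends v E₁ E₂) (hs : Touches ends E₁ s) (ht : Touches ends E₁ t) (k : ℕ) :
    cutIn ends s t (E₁ ∪ E₂) k = cutIn ends s t E₁ k := by
  rw [cutIn_eq_preimage, cutIn_eq_preimage, genIn_sep_union_pendant hE hs ht]

/-- **row B2* on every graph whose terminal core is in `CutNet`** -/
theorem cut_logconcave_of_CutNet_core {p : E → ℝ} (hp : IsProbVec p) {ends : E → Sym2 V} {v s t : V}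
    {E₁ E₂ : Finset E} (h : CutNet ends s t E₁) (hE : SharesOnlyVertex ends v E₁ E₂)
    (hs : Touches ends E₁ s) (ht : Touches ends E₁ t) (hcov : E₁ ∪ E₂ = Finset.univ) (k : ℕ) :
    prob p (cutEvent ends s t k) * prob p (cutEvent ends s t (k + 2))
      ≤ prob p (cutEvent ends s t (k + 1)) * prob p (cutEvent ends s t (k + 1)) := by
  have hk := h.cutIn_logconcave hp k
  rw [← cutIn_union_pendant hE hs ht, ← cutIn_union_pendant hE hs ht (k + 2),
    ← cutIn_union_pendant hE hs ht (k + 1), hcov, cutIn_univ, cutIn_univ, cutIn_univ] at hk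
  exact hk

end Summit.Ventures.PercRepro2
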